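import Summits.AtomisticToContinuum.HydrodynamicLimit.Theorems.MourreKoopmanChargesConservedVectorsOneBody
import Literature.Analysis.UnboundedOperators.VirialTheoremIntegrated
import HarnessLib

/-!
# `ConservedVectorsOneBody` (stmt-AtomisticToContinuum-14142) from the engine in its UNBOUNDED form

Third support file for the support item `ConservedVectorsOneBody` of route `MourreKoopmanCharges`
(`Summit.AtomisticToContinuum.HydrodynamicLimit.Theses.MourreKoopmanCharges.ConservedVectorsOneBody`).
The route's informal engine crux `CollisionCommutatorRegularityR` (stmt-13984) posits a conjugate
operator `A` and a reference operator `N ≥ 1` on Spohn's `ℋ` with (ii) `e^{isA}`-invariance of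
`D(L) ∩ D(N)` and (iii) an `N`-form-bounded first commutator `H′ = i[H, A]`, and (v) WEAK
CONJUGACY off the one-body sector (`⟨F, H′F⟩ ≥ 0` on `Q(N)`, `= 0` only for `F ∈ 𝒟`); its
consequence (a) — "virial theorem for unbounded positive commutators ⇒ every eigenvector of `L`
lies in `𝒟`" — is this item. The companion file `MourreKoopmanChargesConservedVectorsOneBody.lean`
typed "(13984) ⇒ (14142)" in the BOUNDED-commutator class `C¹(A; ℋ_ℂ)` (ABG Prop. 7.2.10),
which the crux itself records as failing for free streaming. Here the same implication is typed in
the UNBOUNDED class the crux actually asks for, through the integrated commutator identity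
`H W(s) φ = W(s) H φ + ∫₀^s W(s-u) B W(u) φ du` on a `W`-invariant regular domain `S ⊆ D(H)`
(`Literature.Analysis.UnboundedOperators.UnitaryRep.HasIntegratedCommutatorOn`, whose virial
theorem `⟪ψ, B ψ⟫ = 0` for invariant `ψ ∈ S` is PROVED in `VirialTheoremIntegrated.lean`):

* `conservedSpace_le_oneBodySector_of_integratedCommutator`: for one strongly continuous datum,
  (13984-(ii)+(iii) in integrated form on `S`) + (REGULARITY: every conserved vector lies in `S`)
  + (13984-(v) on `S`: `⟪u, B u⟫ = 0 ∧ u ∈ S ⇒ u ∈ 𝒟_ℂ`) ⇒ `F.conservedSpace ≤ F.oneBodySector`;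
* `conservedVectorsOneBody_of_integratedCommutator`: the item's quantifier shape;
* `…_domain` variants: in Mourre's `H`-bounded class (`S = D(H)`) the regularity clause is
  automatic (`Ker H ⊆ D(H)`).

The middle hypothesis is the point of this file: with `S = D(L) ∩ D(N)` the virial theorem needs
the invariant vector to be `N`-regular, which clauses (i)–(v) of stmt-13984 do not provide (the
`(A, N)` literature proves it separately from a lower bound `H′ ≥ 𝒫 - C`: Fröhlich–Merkli 2004
Thm 3.4; Georgescu–Gérard–Møller 2004) — the refuter's sharpening S1 of CruxAttack_13984.md
("add clause (vi) `Ker L ⊆ Q(N)` or strengthen (v), or file the glue honestly"), here filed as a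
typed hypothesis.

References: E. Mourre, Comm. Math. Phys. 78 (1981), Prop. II.4; J. Fröhlich, M. Merkli,
Math. Phys. Anal. Geom. 7 (2004), Thm 3.2, Thm 3.4; V. Georgescu, C. Gérard, J. S. Møller,
Comm. Math. Phys. 249 (2004).
-/

noncomputable section

open Filter Set MeasureTheory
open scoped InnerProductSpace Topology

namespace Summit.AtomisticToContinuum.HydrodynamicLimit.Theorems

open Literature.MathematicalPhysics.KineticTheory Literature.Analysis.UnboundedOperators
open Summit.AtomisticToContinuum.HydrodynamicLimit.Theses.MourreKoopmanCharges (ConservedVectorsOneBody)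

namespace MourreKoopmanChargesConservedVectorsOneBody

section HardSpheres

variable {σ : ℝ} (F : HardSphereFluctuationData σ)

/-- **Virial road in the unbounded class, one datum.** Let the hard-sphere Koopman group be
strongly continuous, `U(t)` its unitary group on `ℋ_ℂ` with Liouvillean `H`, and suppose:
(13984-(ii)+(iii), integrated form) `H` has the integrated first commutator `B` with respect to a
conjugate group `W(s) = e^{isA}` on a `W`-invariant regular domain `S ⊆ D(H)`;
(REGULARITY, the clause the `(A, N)` virial theorem needs) every conserved vector, complexified,
lies in `S`; (13984-(v) on `S`, weak conjugacy off `𝒟`) a regular vector with `⟪u, B u⟫ = 0` lies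
in `𝒟_ℂ`. Then every conserved vector lies in the one-body sector — by the virial theorem
`HasIntegratedCommutatorOn.inner_comm_eq_zero_of_mem_invariantVectors`. [folklore] -/
theorem conservedSpace_le_oneBodySector_of_integratedCommutator (h : F.IsStronglyContinuous)
    {W : OneParameterUnitaryGroup (Complexification (HardSphereFluctuationSpace F))}
    {S : Set (Complexification (HardSphereFluctuationSpace F))}
    {B : Complexification (HardSphereFluctuationSpace F) →
      Complexification (HardSphereFluctuationSpace F)}
    (hc : UnitaryRep.HasIntegratedCommutatorOn (F.unitaryGroup h) W S B)
    (hreg : ∀ ψ ∈ F.conservedSpace, Complexification.ofReal ψ ∈ S)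
    (hker : ∀ u ∈ S, ⟪u, B u⟫_ℂ = 0 → u ∈ F.oneBodySectorC) :
    F.conservedSpace ≤ F.oneBodySector := by
  intro ψ hψ
  have h0 := hc.inner_comm_eq_zero_of_mem_invariantVectors (hreg ψ hψ)
    (ofReal_mem_invariantVectors F h hψ)
  have hmem := hker _ (hreg ψ hψ) h0
  rw [HardSphereFluctuationData.mem_oneBodySectorC_iff] at hmem
  simpa using hmem.1

/-- **Mourre's own class needs no regularity clause**: if the regular domain is all of `D(H)`
(the first commutator is `H`-bounded, Mourre 1981 (b)–(c)), conserved vectors lie in it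
automatically (`Ker H ⊆ D(H)`), so weak conjugacy off `𝒟` on `D(H)` alone gives the item's
conclusion for the datum. (For the hard-sphere generator this class is expected to be EMPTY —
stmt-13984 records that `H`-boundedness fails already for free streaming — which is why the
general theorem above carries the regular domain `S` and the clause `Ker H ⊆ S`.) [folklore] -/
theorem conservedSpace_le_oneBodySector_of_integratedCommutator_domain (h : F.IsStronglyContinuous)
    {W : OneParameterUnitaryGroup (Complexification (HardSphereFluctuationSpace F))}
    {B : Complexification (HardSphereFluctuationSpace F) →
      Complexification (HardSphereFluctuationSpace F)}
    (hc : UnitaryRep.HasIntegratedCommutatorOn (F.unitaryGroup h) W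
      ((F.unitaryGroup h).hamiltonian.domain : Set (Complexification (HardSphereFluctuationSpace F))) B)
    (hker : ∀ u ∈ (F.unitaryGroup h).hamiltonian.domain, ⟪u, B u⟫_ℂ = 0 → u ∈ F.oneBodySectorC) :
    F.conservedSpace ≤ F.oneBodySector :=
  conservedSpace_le_oneBodySector_of_integratedCommutator F h hc
    (fun _ψ hψ => (LinearPMap.mem_kernel_iff.mp ((F.unitaryGroup h).invariantVectors_le_kernel_hamiltonian
      (ofReal_mem_invariantVectors F h hψ))).1)
    hker

end HardSpheres

/-- **`ConservedVectorsOneBody` from the engine in the unbounded-commutator class.** If for every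
diameter `σ > 0` and inverse temperature `β > 0` there is an activity threshold below which every
hard-sphere Gibbs datum with (a.e.) Alexander flow has a strongly continuous Koopman group whose
Liouvillean admits an integrated first commutator `B` with respect to some conjugate group on a
regular domain `S` CONTAINING THE CONSERVED VECTORS, weakly conjugate off `𝒟` on `S`, then the
route item holds. (Typed form of "stmt-13984 (ii), (iii), (v) + regularity of `Ker L` ⇒
stmt-14142"; it does not assert its hypothesis.) [folklore] -/
theorem conservedVectorsOneBody_of_integratedCommutator
    (hyp : ∀ σ : ℝ, 0 < σ → ∀ β : ℝ, 0 < β → ∃ z₀ : ℝ, 0 < z₀ ∧ ∀ z : ℝ, 0 < z → z < z₀ →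
      ∀ F : HardSphereFluctuationData σ,
        Literature.Analysis.FluidPDE.IsHardSphereGibbs σ z β (0 : V3) F.μ →
        (∃ Φ : Literature.Analysis.FluidPDE.InfiniteHardSphereFlow (Fin 3) σ,
          Φ.IsEquilibriumFlow ∧ ∀ t : ℝ, F.flow t =ᵐ[F.μ] Φ.flow t) →
        ∃ (h : F.IsStronglyContinuous)
          (W : OneParameterUnitaryGroup (Complexification (HardSphereFluctuationSpace F)))
          (S : Set (Complexification (HardSphereFluctuationSpace F)))
          (B : Complexification (HardSphereFluctuationSpace F) →
            Complexification (HardSphereFluctuationSpace F)),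
          UnitaryRep.HasIntegratedCommutatorOn (F.unitaryGroup h) W S B ∧
            (∀ ψ ∈ F.conservedSpace, Complexification.ofReal ψ ∈ S) ∧
            ∀ u ∈ S, ⟪u, B u⟫_ℂ = 0 → u ∈ F.oneBodySectorC) :
    ConservedVectorsOneBody := by
  intro σ hσ β hβ
  obtain ⟨z₀, hz₀, hz⟩ := hyp σ hσ β hβ
  refine ⟨z₀, hz₀, fun z hz1 hz2 F hG hΦ => ?_⟩
  obtain ⟨h, W, S, B, hc, hreg, hker⟩ := hz z hz1 hz2 F hG hΦ
  exact conservedSpace_le_oneBodySector_of_integratedCommutator F h hc hreg hker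

/-- The same in Mourre's `H`-bounded class (regular domain `D(H)`, no regularity clause): if
every low-activity Gibbs datum with Alexander flow has a strongly continuous Koopman group whose
Liouvillean admits an integrated first commutator on all of `D(H)` that is weakly conjugate off
`𝒟` there, the route item holds. [folklore] -/
theorem conservedVectorsOneBody_of_integratedCommutator_domain
    (hyp : ∀ σ : ℝ, 0 < σ → ∀ β : ℝ, 0 < β → ∃ z₀ : ℝ, 0 < z₀ ∧ ∀ z : ℝ, 0 < z → z < z₀ →
      ∀ F : HardSphereFluctuationData σ,
        Literature.Analysis.FluidPDE.IsHardSphereGibbs σ z β (0 : V3) F.μ →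
        (∃ Φ : Literature.Analysis.FluidPDE.InfiniteHardSphereFlow (Fin 3) σ,
          Φ.IsEquilibriumFlow ∧ ∀ t : ℝ, F.flow t =ᵐ[F.μ] Φ.flow t) →
        ∃ (h : F.IsStronglyContinuous)
          (W : OneParameterUnitaryGroup (Complexification (HardSphereFluctuationSpace F)))
          (B : Complexification (HardSphereFluctuationSpace F) →
            Complexification (HardSphereFluctuationSpace F)),
          UnitaryRep.HasIntegratedCommutatorOn (F.unitaryGroup h) W
              ((F.unitaryGroup h).hamiltonian.domain :
                Set (Complexification (HardSphereFluctuationSpace F))) B ∧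
            ∀ u ∈ (F.unitaryGroup h).hamiltonian.domain, ⟪u, B u⟫_ℂ = 0 → u ∈ F.oneBodySectorC) :
    ConservedVectorsOneBody := by
  intro σ hσ β hβ
  obtain ⟨z₀, hz₀, hz⟩ := hyp σ hσ β hβ
  refine ⟨z₀, hz₀, fun z hz1 hz2 F hG hΦ => ?_⟩
  obtain ⟨h, W, B, hc, hker⟩ := hz z hz1 hz2 F hG hΦ
  exact conservedSpace_le_oneBodySector_of_integratedCommutator_domain F h hc hker

end MourreKoopmanChargesConservedVectorsOneBody

end Summit.AtomisticToContinuum.HydrodynamicLimit.Theorems
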